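import Literature.MathematicalPhysics.QuantumFieldTheory.Balaban1983to89.B9Eq376DerivDict
import Literature.MathematicalPhysics.QuantumFieldTheory.Balaban1983to89.B6RandomWalkL2Hom

/-!
# `Balaban1983to89.B9Eq376L2DerivDict` — THE DICTIONARY `D ∘ P`, `P ∘ D*`, `D ∘ P ∘ D*` ↔ `∇_μ·P`, `P·∇_ν`, `∇_μ·P·∇_ν` IN THE BLOCK-`ℓ²` SHAPE

The block-`ℓ²` ((2.140) of [4]) twin of `B9Eq376DerivDict` §3: the typed composites of the differential letters `D = conjHom b (gradLin T c V)`
(sites → bonds) and `D* = conjHom b (divLin T c V)` (bonds → sites) with a site letter `P` read, direction by direction, as the one-carrier words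
`conj b (diffLetter T V c (inl μ)) * P`, `P * conj b (diffLetter T V c (inr ν))`, `conj b (∇_μ) * P * conj b (∇_ν)` of the frames
(`B9Eq376DerivDict.conjHom_gradLin_comp_apply`, `comp_conjHom_divLin_apply`, `conjHom_gradLin_comp_comp_divLin_apply` — imported, not restated):

* §1 the `ℓ²` size of a bond function is the `ℓ²` sum of its direction components (`l2n_sq_eq_sum_dirRestr`), pieces and block supports restrict
  direction by direction, Cauchy–Schwarz over the directions (`sum_l2n_dirRestr_le`);
* §2 ★ `hasL2MajorantHom_gradLin_comp` (`∀ μ, ∇_μ·P ≺₂ K ⟹ D ∘ P ≺₂ √#κ·K`), `hasL2MajorantHom_gradLin` (the `P = G` form),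
  ★ `hasL2MajorantHom_comp_divLin` (`∀ ν, P·∇_ν ≺₂ K, K ≧ 0 ⟹ P ∘ D* ≺₂ √#κ·K`), `hasL2MajorantHom_divLin`,
  ★ `hasL2Majorant_gradLin_comp_comp_divLin` (`∀ μ ν, ∇_μ·P·∇_ν ≺₂ K, K ≧ 0 ⟹ D ∘ P ∘ D* ≺₂ #κ·K` — the SAME constant as the sup shape).

The sup shape pays `1, #κ, #κ`; the `ℓ²` shape pays `√#κ, √#κ, #κ` (Pythagoras over the output directions, Cauchy–Schwarz over the input directions).
These are the shapes `hDP`, `hPDs`, `hDPpDs` of `B9Ineq377L2Hom.ineq377_l2_concreteE` from per-direction block-`ℓ²` readings.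

count-neutral; NOT a node discharge; nothing continuum ∕ OS ∕ mass-gap ∕ Clay.  Cell `pub-ymgap` (HUMAN RULING D-0062), Track A node N06 [B9],
N06-ASSIGNMENT row 13 (G-side `ℓ²` route), seat `pub-ymgap-dag-n06-c` (g5), 2026-08-27.
-/

noncomputable section

open scoped BigOperators

namespace Literature.MathematicalPhysics.QuantumFieldTheory.Balaban1983to89.B9Eq376L2DerivDict

open Literature.MathematicalPhysics.QuantumFieldTheory.Balaban1983to89
open Literature.MathematicalPhysics.QuantumFieldTheory.Balaban1983to89.B6RandomWalk (blockPiece)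
open Literature.MathematicalPhysics.QuantumFieldTheory.Balaban1983to89.B6RandomWalkL2 (l2n l2n_nonneg l2n_sq l2n_sum_le l2n_smul
  blockPiece_sum HasL2Majorant)
open Literature.MathematicalPhysics.QuantumFieldTheory.Balaban1983to89.B6RandomWalkL2Hom (HasL2MajorantHom)
open Literature.MathematicalPhysics.QuantumFieldTheory.Balaban1983to89.B9Thm34Ext (toB6)
open Literature.MathematicalPhysics.QuantumFieldTheory.Balaban1983to89.B9Eq352DivFormLetters (conj)
open Literature.MathematicalPhysics.QuantumFieldTheory.Balaban1983to89.B9Eq352GradLetters (diffLetter)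
open Literature.MathematicalPhysics.QuantumFieldTheory.Balaban1983to89.B9Eq376POneLetters (conjHom gradLin divLin)
open Literature.MathematicalPhysics.QuantumFieldTheory.Balaban1983to89.B9Eq376DerivDict (dirRestr dirRestr_apply conjHom_gradLin_comp_apply
  comp_conjHom_divLin_apply conjHom_gradLin_comp_comp_divLin_apply)

/-! ## §1  `ℓ²` sizes on the bond carrier, direction by direction -/

section Directions

variable {ι : Type} [Fintype ι] {S : Type} [Fintype S] {κ : Type} [Fintype κ]

/-- PYTHAGORAS OVER THE DIRECTIONS: `‖F‖² = Σ_ν ‖F_ν‖²` for a bond function `F` and its direction components `F_ν = dirRestr ν F`.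
[cite: Balaban1985BackgroundPropagators, (3.39) p.397 + (3.8) p.392; Balaban1984PropagatorsII, (2.140) p.247 (bookkeeping, ours)] -/
theorem l2n_sq_eq_sum_dirRestr (F : (κ × S) × ι → ℝ) : l2n F ^ 2 = ∑ ν, l2n (dirRestr ν F) ^ 2 := by
  simp only [l2n_sq, Fintype.sum_prod_type, dirRestr_apply]

/-- each direction component is no larger than the bond function: `‖F_ν‖ ≦ ‖F‖`. [cite: Balaban1984PropagatorsII, (2.140) p.247 (bookkeeping, ours)] -/
theorem l2n_dirRestr_le (F : (κ × S) × ι → ℝ) (ν : κ) : l2n (dirRestr ν F) ≤ l2n F := by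
  have h : l2n (dirRestr ν F) ^ 2 ≤ l2n F ^ 2 := by
    rw [l2n_sq_eq_sum_dirRestr F]
    exact Finset.single_le_sum (fun μ _ => sq_nonneg (l2n (dirRestr μ F))) (Finset.mem_univ ν)
  exact (le_abs_self _).trans (abs_le_of_sq_le_sq h (l2n_nonneg F))

/-- finite Cauchy–Schwarz in square-root form. [folklore] -/
private theorem sum_mul_le_sqrt_mul_sqrt {α : Type*} (s : Finset α) (u v : α → ℝ) :
    ∑ p ∈ s, u p * v p ≤ Real.sqrt (∑ p ∈ s, u p ^ 2) * Real.sqrt (∑ p ∈ s, v p ^ 2) := by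
  rw [← Real.sqrt_mul (Finset.sum_nonneg fun p _ => sq_nonneg (u p))]
  exact (le_abs_self _).trans (Real.abs_le_sqrt (Finset.sum_mul_sq_le_sq_mul_sq s u v))

/-- CAUCHY–SCHWARZ OVER THE DIRECTIONS: `Σ_ν ‖F_ν‖ ≦ √#κ·‖F‖`. [cite: Balaban1985BackgroundPropagators, (3.8) p.392; Balaban1984PropagatorsII, (2.140) p.247 (bookkeeping, ours)] -/
theorem sum_l2n_dirRestr_le (F : (κ × S) × ι → ℝ) : ∑ ν, l2n (dirRestr ν F) ≤ Real.sqrt (Fintype.card κ) * l2n F := by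
  have h := sum_mul_le_sqrt_mul_sqrt (Finset.univ : Finset κ) (fun _ => (1 : ℝ)) (fun ν => l2n (dirRestr ν F))
  simp only [one_mul, one_pow, Finset.sum_const, Finset.card_univ, nsmul_eq_mul, mul_one] at h
  rwa [← l2n_sq_eq_sum_dirRestr, Real.sqrt_sq (l2n_nonneg F)] at h

variable {g : B6.Geometry}

omit [Fintype ι] [Fintype S] [Fintype κ] in
/-- the direction-`ν` component of a piece `Δ(y)W` of a bond function (bond block map = block of the base point) is the piece `Δ(y)W_ν`.
[cite: Balaban1984PropagatorsII, (2.52) p.232 (bookkeeping, ours)] -/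
theorem dirRestr_blockPiece (blk : S → g.Site) (y : g.Site) (W : (κ × S) × ι → ℝ) (ν : κ) :
    dirRestr ν (blockPiece (fun q : (κ × S) × ι => blk q.1.2) y W) = blockPiece (fun p : S × ι => blk p.1) y (dirRestr ν W) := by
  funext p; rfl

omit [Fintype ι] [Fintype S] [Fintype κ] in
/-- a bond function supported in the block `y′` restricts, in every direction, to a site function supported in the block `y′`.
[cite: Balaban1984PropagatorsII, (2.51) p.232 (bookkeeping, ours)] -/
theorem supported_dirRestr (blk : S → g.Site) {F : (κ × S) × ι → ℝ} {y' : g.Site}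
    (hF : ∀ q : (κ × S) × ι, blk q.1.2 ≠ y' → F q = 0) (ν : κ) : ∀ p : S × ι, blk p.1 ≠ y' → dirRestr ν F p = 0 :=
  fun p hp => hF ((ν, p.1), p.2) hp

/-- `a² ≦ n·c²` with `a, c, n ≧ 0` ⟹ `a ≦ √n·c`. [folklore] -/
private theorem le_sqrt_mul_of_sq_le {a c n : ℝ} (ha : 0 ≤ a) (hc : 0 ≤ c) (hn : 0 ≤ n) (h : a ^ 2 ≤ n * c ^ 2) :
    a ≤ Real.sqrt n * c := by
  have h1 : Real.sqrt (a ^ 2) ≤ Real.sqrt (n * c ^ 2) := Real.sqrt_le_sqrt h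
  rwa [Real.sqrt_sq ha, Real.sqrt_mul hn, Real.sqrt_sq hc] at h1

omit [Fintype ι] [Fintype S] [Fintype κ] in
/-- pieces of a negated function. [folklore] -/
private theorem blockPiece_neg' (blk : S × ι → g.Site) (y : g.Site) (u : S × ι → ℝ) :
    blockPiece blk y (-u) = -blockPiece blk y u := by
  funext p
  by_cases hp : blk p = y <;> simp [blockPiece, hp]

omit [Fintype κ] in
/-- `‖−u‖ = ‖u‖`. [folklore] -/
private theorem l2n_neg' (u : S × ι → ℝ) : l2n (-u) = l2n u := by
  rw [← neg_one_smul ℝ u, l2n_smul]; simp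

end Directions

/-! ## §2  The dictionary for block-`ℓ²` majorants -/

section Dictionary

variable {𝔸 : Type*} [NormedRing 𝔸] [NormedAlgebra ℂ 𝔸] {ι : Type} [Fintype ι]
variable (b : Module.Basis ι ℝ 𝔸) {S : Type} [Fintype S] {κ : Type} [Fintype κ]
variable (T : κ → Equiv.Perm S) (V : κ → S → 𝔸ˣ)
variable {g : B9.Geometry} [Fintype g.Site] {R : ℝ} {H : Prop}

/-- **Sites → bonds, block-`ℓ²`**: if every directional dressing `∇_{inl μ}·P` (`μ ∈ κ`) of a site letter `P` has the block-`ℓ²` majorant `K`, then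
`D ∘ P : (S × ι → ℝ) → ((κ × S) × ι → ℝ)` has the two-carrier block-`ℓ²` majorant `√#κ·K` (Pythagoras over the output directions: the piece `Δ(y)` of
`(D ∘ P)m` on the bonds is the family of the pieces `Δ(y)((∇_μ·P)m)`, `μ ∈ κ`).  Twin of `B9Eq376DerivDict.hasMajorantHom_gradLin_comp` (sup: factor 1).
[cite: Balaban1985BackgroundPropagators, (3.3) p.391 + (3.42) p.397 + (3.49) p.399 + (3.68) p.403; Balaban1984PropagatorsII, (2.51) p.232 + (2.140) p.247] -/
theorem hasL2MajorantHom_gradLin_comp (blk : S → g.Site) (c : ℂ) {P : Module.End ℝ (S × ι → ℝ)} {K : g.Site → g.Site → ℝ}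
    (h : ∀ μ : κ, HasL2Majorant (g := toB6 g R H) (fun p : S × ι => blk p.1) (conj b (diffLetter T V c (Sum.inl μ)) * P) K) :
    HasL2MajorantHom (g := toB6 g R H) (fun p : S × ι => blk p.1) (fun q : (κ × S) × ι => blk q.1.2)
      (conjHom b (gradLin T c V) ∘ₗ P) (fun a a' => Real.sqrt (Fintype.card κ) * K a a') := by
  intro y y' m hm
  set W := (conjHom b (gradLin T c V) ∘ₗ P) m with hW
  have hdir : ∀ μ : κ, dirRestr μ (blockPiece (fun q : (κ × S) × ι => blk q.1.2) y W)
      = blockPiece (fun p : S × ι => blk p.1) y ((conj b (diffLetter T V c (Sum.inl μ)) * P) m) := fun μ => by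
    rw [dirRestr_blockPiece]
    have e1 : dirRestr μ W = (conj b (diffLetter T V c (Sum.inl μ)) * P) m := by
      funext p; rw [dirRestr_apply, hW, conjHom_gradLin_comp_apply]
    rw [e1]
  have hμ : ∀ μ : κ, l2n (dirRestr μ (blockPiece (fun q : (κ × S) × ι => blk q.1.2) y W)) ≤ K y y' * l2n m := fun μ => by
    rw [hdir μ]; exact h μ y y' m hm
  have hsq : l2n (blockPiece (fun q : (κ × S) × ι => blk q.1.2) y W) ^ 2 ≤ (Fintype.card κ : ℝ) * (K y y' * l2n m) ^ 2 := by
    rw [l2n_sq_eq_sum_dirRestr]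
    calc ∑ μ, l2n (dirRestr μ (blockPiece (fun q : (κ × S) × ι => blk q.1.2) y W)) ^ 2
        ≤ ∑ _μ : κ, (K y y' * l2n m) ^ 2 := Finset.sum_le_sum fun μ _ => pow_le_pow_left₀ (l2n_nonneg _) (hμ μ) 2
      _ = (Fintype.card κ : ℝ) * (K y y' * l2n m) ^ 2 := by rw [Finset.sum_const, Finset.card_univ, nsmul_eq_mul]
  by_cases hc : 0 ≤ K y y' * l2n m
  · calc l2n (blockPiece (fun q : (κ × S) × ι => blk q.1.2) y W) ≤ Real.sqrt (Fintype.card κ) * (K y y' * l2n m) :=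
          le_sqrt_mul_of_sq_le (l2n_nonneg _) hc (Nat.cast_nonneg _) hsq
      _ = Real.sqrt (Fintype.card κ) * K y y' * l2n m := by ring
  · have hκ : Fintype.card κ = 0 := Fintype.card_eq_zero_iff.mpr ⟨fun μ => hc ((l2n_nonneg _).trans (hμ μ))⟩
    have hsq' : l2n (blockPiece (fun q : (κ × S) × ι => blk q.1.2) y W) ^ 2 ≤ 0 := by simpa [hκ] using hsq
    have h0 : Real.sqrt (Fintype.card κ : ℝ) * K y y' * l2n m = 0 := by simp [hκ]
    rw [h0]
    nlinarith [l2n_nonneg (blockPiece (fun q : (κ × S) × ι => blk q.1.2) y W)]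

/-- The `P = G` form: `(∀ μ, ∇_{inl μ}·G ≺₂ K) → D ∘ G ≺₂ √#κ·K` (site letter written as the right factor).
[cite: Balaban1985BackgroundPropagators, (3.3) p.391 + (3.42) p.397; Balaban1984PropagatorsII, (2.51) p.232 + (2.140) p.247] -/
theorem hasL2MajorantHom_gradLin (blk : S → g.Site) (c : ℂ) {G : Module.End ℝ (S × ι → ℝ)} {K : g.Site → g.Site → ℝ}
    (h : ∀ μ : κ, HasL2Majorant (g := toB6 g R H) (fun p : S × ι => blk p.1) (conj b (diffLetter T V c (Sum.inl μ)) * G) K) :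
    HasL2MajorantHom (g := toB6 g R H) (fun p : S × ι => blk p.1) (fun q : (κ × S) × ι => blk q.1.2)
      (conjHom b (gradLin T c V) ∘ₗ G) (fun a a' => Real.sqrt (Fintype.card κ) * K a a') :=
  hasL2MajorantHom_gradLin_comp (R := R) (H := H) b T V blk c h

/-- **Bonds → sites, block-`ℓ²`**: if every `P·∇_{inr ν}` (`ν ∈ κ`) has the block-`ℓ²` majorant `K ≧ 0`, then `P ∘ D* : ((κ × S) × ι → ℝ) → (S × ι → ℝ)`
has the two-carrier block-`ℓ²` majorant `√#κ·K` (`D* = Σ_ν D*_ν`, (3.8); Cauchy–Schwarz over the input directions `Σ_ν ‖F_ν‖ ≦ √#κ‖F‖`).  Twin of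
`B9Eq376DerivDict.hasMajorantHom_comp_divLin` (sup: factor `#κ`).
[cite: Balaban1985BackgroundPropagators, (3.8) p.392 + (3.42) p.397 + (3.49) p.399 + (3.68) p.403; Balaban1984PropagatorsII, (2.51) p.232 + (2.140) p.247] -/
theorem hasL2MajorantHom_comp_divLin (blk : S → g.Site) (c : ℂ) {P : Module.End ℝ (S × ι → ℝ)} {K : g.Site → g.Site → ℝ}
    (hK : ∀ a a', 0 ≤ K a a')
    (h : ∀ ν : κ, HasL2Majorant (g := toB6 g R H) (fun p : S × ι => blk p.1) (P * conj b (diffLetter T V c (Sum.inr ν))) K) :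
    HasL2MajorantHom (g := toB6 g R H) (fun q : (κ × S) × ι => blk q.1.2) (fun p : S × ι => blk p.1)
      (P ∘ₗ conjHom b (divLin T c V)) (fun a a' => Real.sqrt (Fintype.card κ) * K a a') := by
  intro y y' F hF
  have hFν : ∀ (ν : κ) (p : S × ι), blk p.1 ≠ y' → dirRestr ν F p = 0 := fun ν p hp => hF ((ν, p.1), p.2) hp
  rw [comp_conjHom_divLin_apply, blockPiece_neg', l2n_neg', blockPiece_sum]
  calc l2n (∑ ν, blockPiece (fun p : S × ι => blk p.1) y ((P * conj b (diffLetter T V c (Sum.inr ν))) (dirRestr ν F)))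
      ≤ ∑ ν, l2n (blockPiece (fun p : S × ι => blk p.1) y ((P * conj b (diffLetter T V c (Sum.inr ν))) (dirRestr ν F))) :=
        l2n_sum_le _ _
    _ ≤ ∑ ν, K y y' * l2n (dirRestr ν F) := Finset.sum_le_sum fun ν _ => h ν y y' _ (hFν ν)
    _ = K y y' * ∑ ν, l2n (dirRestr ν F) := by rw [Finset.mul_sum]
    _ ≤ K y y' * (Real.sqrt (Fintype.card κ) * l2n F) := mul_le_mul_of_nonneg_left (sum_l2n_dirRestr_le F) (hK _ _)
    _ = Real.sqrt (Fintype.card κ) * K y y' * l2n F := by ring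

/-- The `P = G` form: `(∀ ν, G·∇_{inr ν} ≺₂ K, K ≧ 0) → G ∘ D* ≺₂ √#κ·K`.
[cite: Balaban1985BackgroundPropagators, (3.8) p.392 + (3.42) p.397; Balaban1984PropagatorsII, (2.51) p.232 + (2.140) p.247] -/
theorem hasL2MajorantHom_divLin (blk : S → g.Site) (c : ℂ) {G : Module.End ℝ (S × ι → ℝ)} {K : g.Site → g.Site → ℝ}
    (hK : ∀ a a', 0 ≤ K a a')
    (h : ∀ ν : κ, HasL2Majorant (g := toB6 g R H) (fun p : S × ι => blk p.1) (G * conj b (diffLetter T V c (Sum.inr ν))) K) :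
    HasL2MajorantHom (g := toB6 g R H) (fun q : (κ × S) × ι => blk q.1.2) (fun p : S × ι => blk p.1)
      (G ∘ₗ conjHom b (divLin T c V)) (fun a a' => Real.sqrt (Fintype.card κ) * K a a') :=
  hasL2MajorantHom_comp_divLin (R := R) (H := H) b T V blk c hK h

/-- **Bonds → bonds, two-sided, block-`ℓ²`**: if every `∇_{inl μ}·P·∇_{inr ν}` has the block-`ℓ²` majorant `K ≧ 0`, then `D ∘ P ∘ D*` has the
block-`ℓ²` majorant `#κ·K` on the bond carrier (`√#κ` from the output directions times `√#κ` from the input directions — the SAME constant as the sup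
twin `B9Eq376DerivDict.hasMajorant_gradLin_comp_comp_divLin`).
[cite: Balaban1985BackgroundPropagators, (3.3) p.391 + (3.8) p.392 + (3.68) p.403; Balaban1984PropagatorsII, (2.51) p.232 + (2.140) p.247] -/
theorem hasL2Majorant_gradLin_comp_comp_divLin (blk : S → g.Site) (c : ℂ) {P : Module.End ℝ (S × ι → ℝ)} {K : g.Site → g.Site → ℝ}
    (hK : ∀ a a', 0 ≤ K a a')
    (h : ∀ μ ν : κ, HasL2Majorant (g := toB6 g R H) (fun p : S × ι => blk p.1)
      (conj b (diffLetter T V c (Sum.inl μ)) * P * conj b (diffLetter T V c (Sum.inr ν))) K) :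
    HasL2Majorant (g := toB6 g R H) (fun q : (κ × S) × ι => blk q.1.2)
      (conjHom b (gradLin T c V) ∘ₗ P ∘ₗ conjHom b (divLin T c V)) (fun a a' => Fintype.card κ * K a a') := by
  intro y y' F hF
  have hFν : ∀ (ν : κ) (p : S × ι), blk p.1 ≠ y' → dirRestr ν F p = 0 := fun ν p hp => hF ((ν, p.1), p.2) hp
  set W := (conjHom b (gradLin T c V) ∘ₗ P ∘ₗ conjHom b (divLin T c V)) F with hW
  have hμ : ∀ μ : κ, l2n (dirRestr μ (blockPiece (fun q : (κ × S) × ι => blk q.1.2) y W))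
      ≤ K y y' * (Real.sqrt (Fintype.card κ) * l2n F) := by
    intro μ
    have e : dirRestr μ (blockPiece (fun q : (κ × S) × ι => blk q.1.2) y W) = blockPiece (fun p : S × ι => blk p.1) y
        (-∑ ν, (conj b (diffLetter T V c (Sum.inl μ)) * P * conj b (diffLetter T V c (Sum.inr ν))) (dirRestr ν F)) := by
      rw [dirRestr_blockPiece]
      have e1 : dirRestr μ W
          = -∑ ν, (conj b (diffLetter T V c (Sum.inl μ)) * P * conj b (diffLetter T V c (Sum.inr ν))) (dirRestr ν F) := by
        funext p; rw [dirRestr_apply, hW, conjHom_gradLin_comp_comp_divLin_apply, Pi.neg_apply, Finset.sum_apply]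
      rw [e1]
    rw [e, blockPiece_neg', l2n_neg', blockPiece_sum]
    calc l2n (∑ ν, blockPiece (fun p : S × ι => blk p.1) y
            ((conj b (diffLetter T V c (Sum.inl μ)) * P * conj b (diffLetter T V c (Sum.inr ν))) (dirRestr ν F)))
        ≤ ∑ ν, l2n (blockPiece (fun p : S × ι => blk p.1) y
            ((conj b (diffLetter T V c (Sum.inl μ)) * P * conj b (diffLetter T V c (Sum.inr ν))) (dirRestr ν F))) := l2n_sum_le _ _
      _ ≤ ∑ ν, K y y' * l2n (dirRestr ν F) := Finset.sum_le_sum fun ν _ => h μ ν y y' _ (hFν ν)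
      _ = K y y' * ∑ ν, l2n (dirRestr ν F) := by rw [Finset.mul_sum]
      _ ≤ K y y' * (Real.sqrt (Fintype.card κ) * l2n F) := mul_le_mul_of_nonneg_left (sum_l2n_dirRestr_le F) (hK _ _)
  have hc : 0 ≤ K y y' * (Real.sqrt (Fintype.card κ) * l2n F) :=
    mul_nonneg (hK _ _) (mul_nonneg (Real.sqrt_nonneg _) (l2n_nonneg _))
  have hsq : l2n (blockPiece (fun q : (κ × S) × ι => blk q.1.2) y W) ^ 2
      ≤ (Fintype.card κ : ℝ) * (K y y' * (Real.sqrt (Fintype.card κ) * l2n F)) ^ 2 := by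
    rw [l2n_sq_eq_sum_dirRestr]
    calc ∑ μ, l2n (dirRestr μ (blockPiece (fun q : (κ × S) × ι => blk q.1.2) y W)) ^ 2
        ≤ ∑ _μ : κ, (K y y' * (Real.sqrt (Fintype.card κ) * l2n F)) ^ 2 :=
          Finset.sum_le_sum fun μ _ => pow_le_pow_left₀ (l2n_nonneg _) (hμ μ) 2
      _ = (Fintype.card κ : ℝ) * (K y y' * (Real.sqrt (Fintype.card κ) * l2n F)) ^ 2 := by
          rw [Finset.sum_const, Finset.card_univ, nsmul_eq_mul]
  calc l2n (blockPiece (fun q : (κ × S) × ι => blk q.1.2) y W)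
      ≤ Real.sqrt (Fintype.card κ) * (K y y' * (Real.sqrt (Fintype.card κ) * l2n F)) :=
        le_sqrt_mul_of_sq_le (l2n_nonneg _) hc (Nat.cast_nonneg _) hsq
    _ = Real.sqrt (Fintype.card κ) * Real.sqrt (Fintype.card κ) * K y y' * l2n F := by ring
    _ = Fintype.card κ * K y y' * l2n F := by rw [Real.mul_self_sqrt (Nat.cast_nonneg _)]

end Dictionary

end Literature.MathematicalPhysics.QuantumFieldTheory.Balaban1983to89.B9Eq376L2DerivDict
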